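import Literature.NumberTheory.EllipticCurves.SkinnerUrban2014.CharacteristicIdealBaseChangeProofs
import Literature.NumberTheory.EllipticCurves.CyclotomicIwasawaMainTheoremIrreducibleProofs
import Literature.RingTheory.IntegralClosure.KrullIntersection
import HarnessLib

/-!
# Skinner–Urban 2014, Corollary 3.2.9 (ii) at its printed generality: NORMAL Noetherian domains
# ("the characteristic ideal is the smallest divisorial ideal containing the Fitting ideal")

C. Skinner, E. Urban, *The Iwasawa main conjectures for `GL₂`*, Invent. Math. 195 (2014), 1–277
(bib key `SkinnerUrban2014`; held author version `paper:doi-10-1007-s00222-013-0448-1`, whose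
three-level numbering and pages are used in every `[cite:]` of the tree for this source).

**§3.1.6, as printed** (pp. 19–20 of the held text): "Recall first that a divisorial ideal is an
ideal which is equal to the intersection of all principal ideals containing it. In particular any
principal ideal is divisorial. Let us assume now that `A` is a noetherian normal domain. For any
prime ideal `Q ⊂ A` of height one, denote by `ord_Q` the essential valuation attached to `Q` …
(`A_Q` is a DVR and `ord_Q(I)` is the valuation of any generator of `I A_Q`). … The characteristic
ideal of an `A`-module `X` is the divisorial ideal `Char_A(X) := {x ∈ A : ord_Q(x) ≥ ℓ_Q(X) ∀ Q of
height one}`, where `ℓ_Q(X)` is the `A_Q`-length of the `Q`-localization `X_Q`".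

**Corollary 3.2.9 (ii), as printed** (p. 24): "if `A` and `A/𝔞` are noetherian normal domains then
`(f) mod 𝔞` divides `Ch^Σ_{F,A/𝔞}(T/𝔞)` for any principal ideal `(f) ⊇ Ch^Σ_{F,A}`; in particular,
if `A` is a unique factorization domain then `Ch^Σ_{F,A}(T) mod 𝔞` divides `Ch^Σ_{F,A/𝔞}(T/𝔞)`.
*Proof.* … part (ii) follows from the fact that the characteristic ideal is the smallest divisorial
ideal containing the Fitting ideal (and that principal ideals are divisorial)." ("`I` divides `J`"
means `I ⊇ J`, §3.1.6 (i) ⟺ (ii).) Skinner–Urban USE the normal-domain clause with `A = 𝕀⟦Γ_K⟧`,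
`𝕀` a normal domain finite over `Λ_W` (proof of Cor. 3.6.2, p. 42: "this corollary follows from
combining Theorem 3.6.1 with (3.3.12.b) and part (ii) of Corollary 3.2.9"; Thm. 3.6.6, p. 44).

The tree's `SkinnerUrban2014/CharacteristicIdealBaseChangeProofs.lean` (lit-su gen 6) proves
Cor. 3.2.9 (ii) in the "in particular" / unique-factorization generality and leaves
`-- TODO(general form): A, A/𝔞 Noetherian NORMAL domains (divisorial ideals; needs
A = ⋂_{ht Q = 1} A_Q, not in Mathlib)`. That intersection theorem (Krull; Matsumura, *Commutative
Ring Theory*, Thm. 11.5) IS in the tree — `Literature/RingTheory/IntegralClosure/KrullIntersection`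
(`Literature.RingTheory.IntegralClosure.mem_span_singleton_of_forall_height_eq_one`: in a normal
Noetherian domain, `b ∈ a R_P` for every height-one prime `P` implies `b ∈ aR`; Thm. 11.5 (i):
prime divisors of principal ideals have height one and `R_P` is a DVR there). This file discharges
the TODO: Cor. 3.2.9 (ii) for `A`, `B` (in particular `B = A/𝔞`) Noetherian NORMAL domains, for the
tree's characteristic ideal `Literature.NumberTheory.EllipticCurves.Module.charIdeal A X =
∏_{ht 𝔭 = 1} 𝔭 ^ ℓ_𝔭(X)` (`IwasawaAlgebra.lean`) and Fitting ideal
`Literature.RingTheory.FittingIdeal.Module.fittingIdeal A X 0`.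

Vocabulary check (why the printed statement is the tree statement). Over a normal Noetherian
domain that is not factorial the tree's product ideal `∏ 𝔭^{ℓ_𝔭}` can be strictly smaller than
S–U's divisorial `Char_A(X)` (it need not be divisorial, and `Fitt_A(X) ⊆ ∏ 𝔭^{ℓ_𝔭}` can fail:
`A = k[x,y,z]/(xz − y²)`, `X = A/(x)`, `Q = (x, y)`, `ℓ_Q = 2`, `Q² = x·(x, y, z) ⊉ (x) = Fitt`);
but for a PRINCIPAL ideal `(f)` the two inclusions `∏ 𝔭^{ℓ_𝔭} ⊆ (f)` and `Char_A(X) ⊆ (f)` are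
equivalent — both say `ord_Q(f) ≤ ℓ_Q(X)` for every height-one `Q` (localise at `Q`; conversely
Krull's `A = ⋂ A_Q`) — and Cor. 3.2.9 (ii) only compares characteristic ideals with principal
ideals. So `charIdeal A X ≤ Ideal.span {f}` is the printed "`(f) ⊇ Ch_A(X)`" verbatim.

Contents (theorems only; no `def`, no named fact; D-0014/D-0026):

* `isDiscreteValuationRing_localization_of_height_eq_one` — §3.1.6 "`A_Q` is a DVR" at a
  height-one prime of a normal Noetherian domain (Matsumura Thm. 11.2 / 11.5 (i); Mathlib's
  `IsDiscreteValuationRing.TFAE` with `isIntegrallyClosed_of_isLocalization` and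
  `IsLocalization.AtPrime.ringKrullDim_eq_height`).
* `map_charIdeal_localization_eq_maximalIdeal_pow` — "`ord_Q(Char_A(X)) = ℓ_Q(X)`":
  `Char_A(X) A_Q = (Q A_Q)^{ℓ_Q(X)}` for `X` finite torsion over ANY Noetherian domain (the other
  height-one primes of the finite product become the unit ideal in `A_Q`).
* `map_fittingIdeal_zero_localization_eq_maximalIdeal_pow` — `Fitt_A(X) A_Q = Fitt(X_Q) =
  (Q A_Q)^{ℓ_Q(X)}` (Fitting ideals localise, Stacks 07ZA; `Fitt = 𝔪^{length}` over a DVR,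
  de Smit–Rubin–Schoof §1 — both tree theorems).
* `fittingIdeal_zero_le_span_singleton_of_charIdeal_le` — `Char_A(X) ⊆ (f) ⇒ Fitt_A(X) ⊆ (f)`
  (normal `A`; Krull's intersection theorem prime by prime).
* `charIdeal_le_span_singleton_of_fittingIdeal_zero_le_of_isIntegrallyClosed` — "the characteristic
  ideal is the smallest divisorial ideal containing the Fitting ideal", principal-ideal form over a
  normal Noetherian domain: `Fitt_A(X) ⊆ (g) ⇒ Char_A(X) ⊆ (g)` (`X` torsion); with the previous
  item, `charIdeal_le_span_singleton_iff_of_isIntegrallyClosed`.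
* `charIdeal_baseChange_le_span_singleton_of_isIntegrallyClosed` — **Cor. 3.2.9 (ii), normal
  clause**: `A`, `B` Noetherian normal domains, `B` an `A`-algebra with `X ⊗_A B` torsion,
  `Char_A(X) ⊆ (f) ⇒ Char_B(X ⊗_A B) ⊆ (f·1_B)`; printed quotient form
  `corollary329_charIdeal_quotient_le_span_singleton_of_isIntegrallyClosed` (`B = A/𝔞`) and the
  "`Ch_A(X) mod 𝔞` divides `Ch_{A/𝔞}(X/𝔞X)`" form for principal `Ch_A(X)`
  (`corollary329_charIdeal_quotient_le_map_charIdeal_of_isIntegrallyClosed`).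

On the torsion hypothesis: as in the gen-6 file — the printed convention `ℓ_Q = ∞ ⇒ Char = 0`
makes (ii) vacuous for non-torsion `X ⊗ B`; the tree's `charIdeal` gives exponent `0` to an infinite
length, so (ii) is stated for `X ⊗_A B` torsion (the case of Prop. 3.2.8 / 3.2.11 / Thm. 3.6.4, dual
Selmer groups being torsion by Kato, Thm. 3.3.7). No torsion hypothesis on `X` itself is needed
(`Fitt_A(X) = 0` when `X` is not torsion).

## References

* C. Skinner, E. Urban, Invent. Math. 195 (2014), §3.1.6 (pp. 19–20), Cor. 3.2.9 (p. 24), proof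
  of Cor. 3.6.2 (p. 42). [SkinnerUrban2014]
* H. Matsumura, *Commutative Ring Theory*, CSAM 8 (1986), Thm. 11.2 (p. 79), Thm. 11.5 (p. 82)
  (tree file `Literature/RingTheory/IntegralClosure/KrullIntersection.lean`). [Matsumura1987]
* B. de Smit, K. Rubin, R. Schoof, *Criteria for complete intersections* (1997), §1 p. 347
  (`Fit_A(M) = 𝔪^{length M}` over a DVR; tree `Module.fittingIdeal_zero_eq_maximalIdeal_pow`).
  [DeSmitRubinSchoof1997]
* The Stacks Project, Tag 07ZA (Fitting ideals and base change / localisation; tree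
  `Module.fittingIdeal_baseChange`, `Module.fittingIdeal_of_isLocalizedModule`). [StacksProject]
-/

noncomputable section

open scoped TensorProduct

open Literature.RingTheory.FittingIdeal Literature.NumberTheory.EllipticCurves
  Literature.NumberTheory.EllipticCurves.Module Literature.RingTheory.IntegralClosure IsLocalRing

namespace Literature.NumberTheory.EllipticCurves.SkinnerUrban2014

universe u v w

variable {R : Type u} [CommRing R] [IsDomain R] [IsNoetherianRing R]

/-! ### §3.1.6: `A_Q` is a discrete valuation ring at a height-one prime of a normal domain -/

/-- **§3.1.6: "`A_Q` is a DVR"** for a height-one prime `Q` of a Noetherian normal domain `A`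
(Matsumura Thm. 11.5 (i) / Thm. 11.2: `A_Q` is a normal Noetherian local domain of dimension
`ht Q = 1` whose maximal ideal is its only non-zero prime).
[cite: SkinnerUrban2014, §3.1.6 (p. 19)] [cite: Matsumura1987, Thm. 11.2 (p. 79) and Thm. 11.5 (p. 82)] -/
theorem isDiscreteValuationRing_localization_of_height_eq_one [IsIntegrallyClosed R]
    (P : Ideal R) [P.IsPrime] (hP : P.height = 1) :
    IsDiscreteValuationRing (Localization.AtPrime P) := by
  set Rp := Localization.AtPrime P
  haveI : IsNoetherianRing Rp := IsLocalization.isNoetherianRing P.primeCompl Rp inferInstance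
  haveI : IsIntegrallyClosed Rp :=
    isIntegrallyClosed_of_isLocalization Rp P.primeCompl P.primeCompl_le_nonZeroDivisors
  have hdim : ringKrullDim Rp ≤ 1 := by
    rw [IsLocalization.AtPrime.ringKrullDim_eq_height P Rp, hP]
    exact le_rfl
  haveI : Ring.KrullDimLE 1 Rp := Ring.krullDimLE_iff.mpr hdim
  have hPne : P ≠ ⊥ := Ideal.ne_bot_of_height_eq_one hP
  have hm : maximalIdeal Rp ≠ ⊥ := by
    intro h
    obtain ⟨a, haP, ha0⟩ := Submodule.exists_mem_ne_zero_of_ne_bot hPne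
    have ha : algebraMap R Rp a ∈ maximalIdeal Rp :=
      (IsLocalization.AtPrime.to_map_mem_maximal_iff Rp P a).mpr haP
    rw [h, Ideal.mem_bot] at ha
    exact ha0 (IsLocalization.injective Rp P.primeCompl_le_nonZeroDivisors (by rw [ha, map_zero]))
  have hnf : ¬ IsField Rp := fun hF => hm (IsLocalRing.isField_iff_maximalIdeal_eq.mp hF)
  have htf : IsDiscreteValuationRing Rp ↔
      IsIntegrallyClosed Rp ∧ ∃! Q : Ideal Rp, Q ≠ ⊥ ∧ Q.IsPrime :=
    (IsDiscreteValuationRing.TFAE Rp hnf).out 0 3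
  refine htf.mpr ⟨‹_›, maximalIdeal Rp, ⟨hm, inferInstance⟩, fun Q hQ => ?_⟩
  haveI := hQ.2
  exact IsLocalRing.eq_maximalIdeal (hQ.2.isMaximal_of_ne_bot hQ.1)

/-! ### Localisation of `Char` and `Fitt` at a height-one prime -/

section Local

variable {M : Type v} [AddCommGroup M] [Module R M] [Module.Finite R M]

omit [IsDomain R] [IsNoetherianRing R] in
/-- Transport of a comparison of localised ideals back to `A`: if `I A_𝔭 ⊆ J A_𝔭` then every
`x ∈ I` satisfies `s x ∈ J` for some `s ∉ 𝔭` (Mathlib's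
`IsLocalization.algebraMap_mem_map_algebraMap_iff`). [folklore] -/
private theorem exists_mul_mem_of_map_le (𝔭 : PrimeSpectrum R) {I J : Ideal R}
    (h : I.map (algebraMap R (Localization.AtPrime 𝔭.asIdeal)) ≤
      J.map (algebraMap R (Localization.AtPrime 𝔭.asIdeal)))
    {x : R} (hx : x ∈ I) : ∃ s ∉ 𝔭.asIdeal, s * x ∈ J := by
  obtain ⟨m, hm, hmx⟩ :=
    (IsLocalization.algebraMap_mem_map_algebraMap_iff 𝔭.asIdeal.primeCompl
      (Localization.AtPrime 𝔭.asIdeal) J x).mp (h (Ideal.mem_map_of_mem _ hx))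
  exact ⟨m, hm, hmx⟩

/-- **"`ord_Q(Char_A(X)) = ℓ_Q(X)`"**: at a height-one prime `Q` of a Noetherian domain `A`, the
characteristic ideal of a finite torsion module localises to `Char_A(X) A_Q = (Q A_Q)^{ℓ_Q(X)}` —
`Char_A(X)` is a finite product of powers of height-one primes, and every factor other than
`Q^{ℓ_Q(X)}` becomes the unit ideal in `A_Q` (distinct height-one primes are incomparable).
[cite: SkinnerUrban2014, §3.1.6 (p. 20), definition of `Char_A` via `ord_Q`] -/
theorem map_charIdeal_localization_eq_maximalIdeal_pow (hM : Module.IsTorsion R M)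
    (𝔭 : PrimeSpectrum R) (h𝔭 : 𝔭.asIdeal.height = 1) :
    (charIdeal R M).map (algebraMap R (Localization.AtPrime 𝔭.asIdeal)) =
      maximalIdeal (Localization.AtPrime 𝔭.asIdeal) ^ (lengthAt R M 𝔭).toNat := by
  classical
  set Rp := Localization.AtPrime 𝔭.asIdeal
  obtain ⟨s, hsann, hs0⟩ := Submodule.annihilator_top_inter_nonZeroDivisors hM
  have hs : s ≠ 0 := nonZeroDivisors.ne_zero hs0
  have hsX : Module.IsTorsionBy R M s := fun x =>
    Submodule.mem_annihilator.mp hsann x Submodule.mem_top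
  set F : PrimeSpectrum R → Ideal R := fun 𝔮 => 𝔮.asIdeal ^ (lengthAt R M 𝔮).toNat with hF
  have hfin := finite_heightOne_inter_mulSupport hs hsX
  set t : Finset (PrimeSpectrum R) := hfin.toFinset with ht
  have hchar : charIdeal R M = ∏ 𝔮 ∈ t, F 𝔮 := by
    unfold charIdeal
    refine finprod_mem_eq_prod_of_inter_mulSupport_eq F ?_
    rw [ht, Set.Finite.coe_toFinset, Set.inter_assoc, Set.inter_self]
  -- enlarge `t` by `𝔭` (harmless: if `𝔭 ∉ t` then `F 𝔭 = 1`) and split off the factor at `𝔭`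
  set t' : Finset (PrimeSpectrum R) := insert 𝔭 t with ht'
  have hchar' : charIdeal R M = F 𝔭 * ∏ 𝔮 ∈ t'.erase 𝔭, F 𝔮 := by
    rw [hchar, Finset.mul_prod_erase t' F (Finset.mem_insert_self 𝔭 t), ht',
      Finset.prod_insert_of_eq_one_if_notMem]
    intro h𝔭t
    by_contra hne
    apply h𝔭t
    rw [ht, Set.Finite.mem_toFinset]
    exact ⟨h𝔭, hne⟩
  -- the complementary factor is prime to `𝔭`
  set J : Ideal R := ∏ 𝔮 ∈ t'.erase 𝔭, F 𝔮 with hJ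
  have hJ𝔭 : ¬ J ≤ 𝔭.asIdeal := by
    intro hle
    rw [hJ, Ideal.IsPrime.prod_le 𝔭.isPrime] at hle
    obtain ⟨𝔮, h𝔮, hle⟩ := hle
    have hne : 𝔮 ≠ 𝔭 := Finset.ne_of_mem_erase h𝔮
    have h𝔮t : 𝔮 ∈ t :=
      (Finset.mem_insert.mp (Finset.mem_of_mem_erase h𝔮)).resolve_left hne
    rw [ht, Set.Finite.mem_toFinset] at h𝔮t
    have h1 : 𝔮.asIdeal.height = 1 := h𝔮t.1
    haveI := 𝔭.isPrime
    haveI := 𝔮.isPrime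
    have hle' : 𝔮.asIdeal ≤ 𝔭.asIdeal := Ideal.IsPrime.le_of_pow_le hle
    exact hne (PrimeSpectrum.ext
      (eq_of_height_le_one_of_le h𝔭.le (Ideal.ne_bot_of_height_eq_one h1) hle'))
  have hJmap : J.map (algebraMap R Rp) = ⊤ := by
    obtain ⟨x, hxJ, hx𝔭⟩ := SetLike.not_le_iff_exists.mp hJ𝔭
    exact Ideal.eq_top_of_isUnit_mem _ (Ideal.mem_map_of_mem _ hxJ)
      (IsLocalization.map_units Rp (⟨x, show x ∈ 𝔭.asIdeal.primeCompl from hx𝔭⟩ :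
        𝔭.asIdeal.primeCompl))
  rw [hchar', Ideal.map_mul, hJmap, Ideal.mul_top, hF, Ideal.map_pow,
    Localization.AtPrime.map_eq_maximalIdeal]

/-- **`Fitt_A(X) A_Q = Fitt_{A_Q}(X_Q) = (Q A_Q)^{ℓ_Q(X)}`** at a height-one prime `Q` of a
Noetherian NORMAL domain, for `X` finite torsion: Fitting ideals localise (Stacks 07ZA), `A_Q` is a
DVR, and over a DVR `Fitt = 𝔪^{length}` (de Smit–Rubin–Schoof §1).
[cite: SkinnerUrban2014, §3.1.6 (pp. 19–20)] [cite: DeSmitRubinSchoof1997, §1, p. 347]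
[cite: StacksProject, Tag 07ZA] -/
theorem map_fittingIdeal_zero_localization_eq_maximalIdeal_pow [IsIntegrallyClosed R]
    (hM : Module.IsTorsion R M) (𝔭 : PrimeSpectrum R) (h𝔭 : 𝔭.asIdeal.height = 1) :
    (Module.fittingIdeal R M 0).map (algebraMap R (Localization.AtPrime 𝔭.asIdeal)) =
      maximalIdeal (Localization.AtPrime 𝔭.asIdeal) ^ (lengthAt R M 𝔭).toNat := by
  set Rp := Localization.AtPrime 𝔭.asIdeal
  haveI : IsDiscreteValuationRing Rp :=
    isDiscreteValuationRing_localization_of_height_eq_one 𝔭.asIdeal h𝔭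
  obtain ⟨s, hsann, hs0⟩ := Submodule.annihilator_top_inter_nonZeroDivisors hM
  have hs : s ≠ 0 := nonZeroDivisors.ne_zero hs0
  have hsX : Module.IsTorsionBy R M s := fun x =>
    Submodule.mem_annihilator.mp hsann x Submodule.mem_top
  obtain ⟨n, hn⟩ := ENat.ne_top_iff_exists.mp (lengthAt_ne_top_of_isTorsionBy hs hsX 𝔭 h𝔭.le)
  rw [← hn, ENat.toNat_coe]
  have hlen : Module.length Rp (LocalizedModule 𝔭.asIdeal.primeCompl M) = n := hn.symm
  rw [← Module.fittingIdeal_of_isLocalizedModule 𝔭.asIdeal.primeCompl Rp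
    (LocalizedModule.mkLinearMap 𝔭.asIdeal.primeCompl M) 0]
  exact Module.fittingIdeal_zero_eq_maximalIdeal_pow hlen

/-! ### `Char ⊆ (f) ⟺ Fitt ⊆ (f)` over a normal Noetherian domain (Krull's `A = ⋂ A_Q`) -/

/-- **`Char_A(X) ⊆ (f) ⇒ Fitt_A(X) ⊆ (f)`** over a Noetherian normal domain (for `X` torsion:
prime by prime, `x ∈ Fitt_A(X)` gives `x ∈ Fitt A_Q = (Q A_Q)^{ℓ_Q} = Char_A(X) A_Q ⊆ f A_Q` for
every height-one `Q`, hence `x ∈ fA` by Krull's intersection theorem, Matsumura 11.5 (ii); for `X`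
not torsion `Fitt_A(X) = 0`). In S–U's language: `Fitt ⊆ Char` and `Char ⊆ (f)`.
[cite: SkinnerUrban2014, §3.1.6 (p. 20) and Cor. 3.2.9 (ii) (proof, p. 24)]
[cite: Matsumura1987, Thm. 11.5 (ii) (p. 82)] -/
theorem fittingIdeal_zero_le_span_singleton_of_charIdeal_le [IsIntegrallyClosed R] {f : R}
    (hf : charIdeal R M ≤ Ideal.span {f}) : Module.fittingIdeal R M 0 ≤ Ideal.span {f} := by
  by_cases hM : Module.IsTorsion R M
  swap
  · have hF : Module.fittingIdeal R M 0 = ⊥ :=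
      le_bot_iff.mp ((Module.fittingIdeal_zero_le_annihilator).trans
        (Module.annihilator_eq_bot_of_not_isTorsion hM).le)
    rw [hF]; exact bot_le
  have hf0 : f ≠ 0 := by
    rintro rfl
    refine Module.charIdeal_ne_bot R M (le_bot_iff.mp ?_)
    simpa using hf
  intro x hx
  refine mem_span_singleton_of_forall_height_eq_one hf0 fun P hP hP1 => ?_
  let 𝔭 : PrimeSpectrum R := ⟨P, hP⟩
  refine exists_mul_mem_of_map_le 𝔭 ?_ hx
  rw [map_fittingIdeal_zero_localization_eq_maximalIdeal_pow hM 𝔭 hP1,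
    ← map_charIdeal_localization_eq_maximalIdeal_pow hM 𝔭 hP1]
  exact Ideal.map_mono hf

/-- **"The characteristic ideal is the smallest divisorial ideal containing the Fitting ideal (and
… principal ideals are divisorial)"**, over a Noetherian NORMAL domain, principal-ideal form:
`Fitt_A(X) ⊆ (g) ⇒ Char_A(X) ⊆ (g)` for `X` finite torsion (prime by prime:
`y ∈ Char_A(X)` gives `y ∈ (Q A_Q)^{ℓ_Q} = Fitt(X_Q) = Fitt_A(X) A_Q ⊆ g A_Q` at every height-one
`Q`, then Krull's intersection theorem). The unique-factorization case is the gen-6 tree theorem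
`charIdeal_le_span_singleton_of_fittingIdeal_zero_le`.
[cite: SkinnerUrban2014, §3.1.6 (p. 20) and Cor. 3.2.9 (ii) (proof, p. 24)]
[cite: Matsumura1987, Thm. 11.5 (ii) (p. 82)] -/
theorem charIdeal_le_span_singleton_of_fittingIdeal_zero_le_of_isIntegrallyClosed
    [IsIntegrallyClosed R] (hM : Module.IsTorsion R M) {g : R}
    (hFg : Module.fittingIdeal R M 0 ≤ Ideal.span {g}) : charIdeal R M ≤ Ideal.span {g} := by
  have hg0 : g ≠ 0 := by
    rintro rfl
    refine fittingIdeal_zero_ne_bot_of_isTorsion (M := M) hM (le_bot_iff.mp ?_)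
    simpa using hFg
  intro y hy
  refine mem_span_singleton_of_forall_height_eq_one hg0 fun P hP hP1 => ?_
  let 𝔭 : PrimeSpectrum R := ⟨P, hP⟩
  refine exists_mul_mem_of_map_le 𝔭 ?_ hy
  rw [map_charIdeal_localization_eq_maximalIdeal_pow hM 𝔭 hP1,
    ← map_fittingIdeal_zero_localization_eq_maximalIdeal_pow hM 𝔭 hP1]
  exact Ideal.map_mono hFg

/-- Over a Noetherian normal domain and for a finite torsion module `X`, a principal ideal contains
`Char_A(X)` iff it contains `Fitt_A(X)` (S–U §3.1.6: `Char` is the smallest divisorial ideal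
containing `Fitt`, principal ideals are divisorial). [cite: SkinnerUrban2014, §3.1.6 (p. 20)] -/
theorem charIdeal_le_span_singleton_iff_of_isIntegrallyClosed [IsIntegrallyClosed R]
    (hM : Module.IsTorsion R M) {g : R} :
    charIdeal R M ≤ Ideal.span {g} ↔ Module.fittingIdeal R M 0 ≤ Ideal.span {g} :=
  ⟨fittingIdeal_zero_le_span_singleton_of_charIdeal_le,
    charIdeal_le_span_singleton_of_fittingIdeal_zero_le_of_isIntegrallyClosed hM⟩

end Local

/-! ### Corollary 3.2.9 (ii), the normal-domain clause -/

section BaseChange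

variable [IsIntegrallyClosed R] {M : Type v} [AddCommGroup M] [Module R M] [Module.Finite R M]

/-- **Cor. 3.2.9 (ii), normal clause, base-change form.** Let `A` be a Noetherian normal domain,
`X` a finite `A`-module and `(f) ⊇ Char_A(X)` a principal ideal; for any Noetherian normal domain
`B` that is an `A`-algebra with `X ⊗_A B` torsion, `(f · 1_B) ⊇ Char_B(X ⊗_A B)`. Printed proof
in the kernel: `Fitt_A(X) ⊆ (f)` (`Char` is the smallest divisorial ideal over `Fitt`, and
`Char ⊆ (f)`), `Fitt_B(X ⊗ B) = Fitt_A(X) B ⊆ (f) B` (§3.1.6 base change), and again `Char_B` is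
the smallest divisorial ideal containing `Fitt_B`, `(f)B` being principal hence divisorial.
[cite: SkinnerUrban2014, Cor. 3.2.9 (ii) (p. 24)] -/
theorem charIdeal_baseChange_le_span_singleton_of_isIntegrallyClosed
    (S : Type w) [CommRing S] [Algebra R S] [IsNoetherianRing S] [IsDomain S] [IsIntegrallyClosed S]
    {f : R} (hf : charIdeal R M ≤ Ideal.span {f}) (hT : Module.IsTorsion S (S ⊗[R] M)) :
    charIdeal S (S ⊗[R] M) ≤ Ideal.span {algebraMap R S f} := by
  refine charIdeal_le_span_singleton_of_fittingIdeal_zero_le_of_isIntegrallyClosed hT ?_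
  rw [Module.fittingIdeal_baseChange]
  refine (Ideal.map_mono (fittingIdeal_zero_le_span_singleton_of_charIdeal_le hf)).trans ?_
  rw [Ideal.map_span, Set.image_singleton]

/-- **Cor. 3.2.9 (ii), as printed**: "if `A` and `A/𝔞` are noetherian normal domains then
`(f) mod 𝔞` divides `Ch_{A/𝔞}(T/𝔞)` for any principal ideal `(f) ⊇ Ch_A`" —
`Ch_{A/𝔞}((A/𝔞) ⊗_A X) ⊆ (f mod 𝔞)` (`X/𝔞X = (A/𝔞) ⊗_A X` torsion over `A/𝔞`, the tree's reading
of the printed convention `ℓ_Q = ∞`, module docstring).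
[cite: SkinnerUrban2014, Cor. 3.2.9 (ii) (p. 24)] -/
theorem corollary329_charIdeal_quotient_le_span_singleton_of_isIntegrallyClosed (𝔞 : Ideal R)
    [IsDomain (R ⧸ 𝔞)] [IsIntegrallyClosed (R ⧸ 𝔞)] {f : R}
    (hf : charIdeal R M ≤ Ideal.span {f})
    (hT : Module.IsTorsion (R ⧸ 𝔞) ((R ⧸ 𝔞) ⊗[R] M)) :
    charIdeal (R ⧸ 𝔞) ((R ⧸ 𝔞) ⊗[R] M) ≤ Ideal.span {Ideal.Quotient.mk 𝔞 f} := by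
  have h := charIdeal_baseChange_le_span_singleton_of_isIntegrallyClosed (M := M) (R ⧸ 𝔞) hf hT
  rwa [Ideal.Quotient.algebraMap_eq] at h

/-- **Cor. 3.2.9 (ii), "`Ch_A(T) mod 𝔞` divides `Ch_{A/𝔞}(T/𝔞)`"** whenever `Ch_A(X)` is
principal (in the printed text: "in particular, if `A` is a unique factorization domain"), here
over a Noetherian normal domain `A` with `A/𝔞` a Noetherian normal domain.
[cite: SkinnerUrban2014, Cor. 3.2.9 (ii) (p. 24)] -/
theorem corollary329_charIdeal_quotient_le_map_charIdeal_of_isIntegrallyClosed (𝔞 : Ideal R)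
    [IsDomain (R ⧸ 𝔞)] [IsIntegrallyClosed (R ⧸ 𝔞)] (hprinc : (charIdeal R M).IsPrincipal)
    (hT : Module.IsTorsion (R ⧸ 𝔞) ((R ⧸ 𝔞) ⊗[R] M)) :
    charIdeal (R ⧸ 𝔞) ((R ⧸ 𝔞) ⊗[R] M) ≤ (charIdeal R M).map (Ideal.Quotient.mk 𝔞) := by
  obtain ⟨c, hc⟩ := hprinc
  have hc' : charIdeal R M = Ideal.span {c} := by rw [hc, Ideal.submodule_span_eq]
  rw [hc', Ideal.map_span, Set.image_singleton]
  exact corollary329_charIdeal_quotient_le_span_singleton_of_isIntegrallyClosed 𝔞 hc'.le hT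

end BaseChange

end Literature.NumberTheory.EllipticCurves.SkinnerUrban2014

end
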